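import Literature.NumberTheory.Automorphic.CuspidalGL2LocalEulerFactor
import Literature.NumberTheory.Automorphic.HeckeCharacterLocalComponentSmooth
import Literature.NumberTheory.Automorphic.HeckeCharacterDeepRamificationIndex
import Literature.NumberTheory.Automorphic.CuspidalTwistLocalComponent
import Literature.NumberTheory.Automorphic.LocalComponentBJSatakeParameterIffProofs
import HarnessLib

/-!
# Ramified and deeply ramified twists kill the local Euler factor of a cuspidal `π` on `GL₂(𝔸_F)`
# (Jacquet–Langlands 1970, Props. 3.5, 3.6, 3.8 — global dictionary form)

Topic `Literature/NumberTheory/Automorphic`; proof file (theorems only: no definition, no named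
fact, no instance).  Let `π` be a cuspidal automorphic representation of `GL₂(𝔸_F)` (Borel–Jacquet
datum), `u` a finite place, `ω` a finite-order Hecke character and `π ⊗ ω = π.twist ω hω`.  In the
language of the local Euler polynomials of `CuspidalGL2LocalEulerFactor` (JPSS `L`-polynomials
`HasRSLFactor (1<2) ρ 1 ψ ν P` of irreducible smooth local components `ρ`):

* `hasRSLFactor_localComponent_twist_eq_one_of_not_isUnramifiedAt` — clause **(R)**: if `π` is
  unramified at `u` and `ω` is RAMIFIED at `u`, then every JPSS `L`-polynomial of every local
  component of `π ⊗ ω` at `u` is `1` (`L(s, (π ⊗ ω)_u) = 1`; Jacquet–Langlands 1970, Props. 3.5–3.6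
  via `hasRSLFactor_twist_eq_one_of_spherical_smoothIrrep`).
* `exists_bound_hasRSLFactor_localComponent_twist_eq_one` — clause **(N)**: there is
  `M = M(π, u) > 0` such that for every finite-order `ω` with `ω, ω², …, ω^M` all ramified at `u`,
  every JPSS `L`-polynomial of every local component of `π ⊗ ω` at `u` is `1` (Jacquet–Langlands
  1970, Prop. 3.8 via `exists_unitFiltration_forall_hasRSLFactor_twist_eq_one_smoothIrrep` and the
  index bound `HeckeCharacter.exists_unitFiltration_ne_one_of_forall_pow_not_isUnramifiedAt`).

Dictionary: the local component of `π ⊗ ω` at `u` is `π_u ⊗ (ω_u ∘ det)`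
(`CuspidalAutomorphicRepData.hasLocalComponentAt_twist`) up to isomorphism
(`hasLocalComponentAt_unique_holds`); `ω_u` is smooth (`HeckeCharacter.isOpen_ker_localComponent`);
"ramified" means non-trivial on an element of valuation `1`
(`HeckeCharacter.not_isUnramifiedAt_iff_exists_valuation_eq_one`); "unramified `π`" means a
spherical local component (`exists_mem_fixedPoints_glInt_of_isUnramifiedAt`); and `HasRSLFactor` is
independent of `ψ`, `ν` and the isomorphism class.

## References

* H. Jacquet, R. P. Langlands, *Automorphic Forms on GL(2)*, LNM 114 (1970), Props. 3.5, 3.6,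
  3.8; Thm. 11.1. [JacquetLanglands1970]
* H. Jacquet, I. I. Piatetski-Shapiro, J. A. Shalika, *Rankin–Selberg convolutions*, Amer. J.
  Math. 105 (1983), Thm. 2.7. [JacquetPiatetskiShapiroShalika1983]
-/

noncomputable section

open scoped MatrixGroups NNReal Classical
open MeasureTheory NumberField IsDedekindDomain Polynomial

namespace Literature.NumberTheory.Automorphic

open Literature.NumberTheory.GaloisRepresentations (HeckeCharacter)

variable {F : Type} [Field F] [NumberField F] {hcpt : isCompact_glFiniteIntegralLevel 2 F}

/-- Transport of the vanishing of `L`-polynomials from `(π_u ⊗ c, ψ₀, ν₀)` to every local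
component of a datum having `π_u ⊗ c` as local component, every `ψ` and every `ν`. [folklore] -/
private theorem hasRSLFactor_eq_one_transport
    (π' : AutomorphicRepData (AutomorphyDatum.gl 2 F hcpt)) (u : HeightOneSpectrum (𝓞 F))
    (σ : SmoothIrrep (GL (Fin 2) (u.adicCompletion F))) (hσ : π'.HasLocalComponentAt u σ.ρ)
    {ψ₀ : AddChar (u.adicCompletion F) Circle} (hψ₀ : ψ₀.IsContinuousNontrivial)
    [MeasurableSpace (u.adicCompletion F)] [BorelSpace (u.adicCompletion F)]
    [MeasurableSpace (GL (Fin 1) (u.adicCompletion F) ⧸ upperUnitriangular (Fin 1) (u.adicCompletion F))]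
    [BorelSpace (GL (Fin 1) (u.adicCompletion F) ⧸ upperUnitriangular (Fin 1) (u.adicCompletion F))]
    (ν₀ : Measure (GL (Fin 1) (u.adicCompletion F) ⧸ upperUnitriangular (Fin 1) (u.adicCompletion F)))
    [SMulInvariantMeasure (GL (Fin 1) (u.adicCompletion F))
      (GL (Fin 1) (u.adicCompletion F) ⧸ upperUnitriangular (Fin 1) (u.adicCompletion F)) ν₀]
    [IsFiniteMeasureOnCompacts ν₀] [ν₀.IsOpenPosMeasure]
    (h : ∀ P : ℂ[X], HasRSLFactor Nat.one_lt_two σ.ρ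
      (Representation.trivial ℂ (GL (Fin 1) (u.adicCompletion F)) ℂ) ψ₀ ν₀ P → P = 1)
    (ρ' : SmoothIrrep (GL (Fin 2) (u.adicCompletion F))) (hρ' : π'.HasLocalComponentAt u ρ'.ρ)
    {ψ : AddChar (u.adicCompletion F) Circle} (hψ : ψ.IsContinuousNontrivial)
    (ν : Measure (GL (Fin 1) (u.adicCompletion F) ⧸ upperUnitriangular (Fin 1) (u.adicCompletion F)))
    [SMulInvariantMeasure (GL (Fin 1) (u.adicCompletion F))
      (GL (Fin 1) (u.adicCompletion F) ⧸ upperUnitriangular (Fin 1) (u.adicCompletion F)) ν]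
    [IsFiniteMeasureOnCompacts ν] [ν.IsOpenPosMeasure] {P : ℂ[X]}
    (hP : HasRSLFactor Nat.one_lt_two ρ'.ρ
      (Representation.trivial ℂ (GL (Fin 1) (u.adicCompletion F)) ℂ) ψ ν P) : P = 1 := by
  haveI := ρ'.isIrreducible
  haveI := σ.isIrreducible
  obtain ⟨e⟩ := (IrrClass.mk_eq_mk_iff ρ' σ).1
    (AutomorphicRepData.hasLocalComponentAt_unique_holds π' u ρ' σ hρ' hσ)
  refine h P ?_
  rw [hasRSLFactor_iff_of_smulInvariant Nat.one_lt_two σ.ρ _ ψ₀ ν₀ ν P,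
    hasRSLFactor_iff_of_isContinuousNontrivial σ.ρ hψ₀ hψ ν P,
    ← hasRSLFactor_iff_of_equiv_left e P]
  exact hP

/-- **Clause (R): a ramified twist of an unramified `π_u` has trivial local factor, for every
local component of the global twist** (Jacquet–Langlands 1970, Props. 3.5–3.6): `π` cuspidal on
`GL₂(𝔸_F)` unramified at `u`, `ω` of finite order ramified at `u`; then every JPSS `L`-polynomial
`P` of every irreducible smooth local component of `π ⊗ ω` at `u` (any `ψ`, any `ν`) is `1`.
[cite: JacquetLanglands1970, Prop. 3.5, Prop. 3.6] -/
theorem hasRSLFactor_localComponent_twist_eq_one_of_not_isUnramifiedAt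
    (π : CuspidalAutomorphicRepData 2 F hcpt) (u : HeightOneSpectrum (𝓞 F))
    (hπ : π.1.IsUnramifiedAt u) (ω : HeckeCharacter F) (hω : ω.IsFiniteOrder)
    (hram : ¬ ω.IsUnramifiedAt u)
    (ρ' : SmoothIrrep (GL (Fin 2) (u.adicCompletion F)))
    (hρ' : (π.twist ω hω).1.HasLocalComponentAt u ρ'.ρ)
    {ψ : AddChar (u.adicCompletion F) Circle} (hψ : ψ.IsContinuousNontrivial)
    [MeasurableSpace (u.adicCompletion F)] [BorelSpace (u.adicCompletion F)]
    [MeasurableSpace (GL (Fin 1) (u.adicCompletion F) ⧸ upperUnitriangular (Fin 1) (u.adicCompletion F))]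
    [BorelSpace (GL (Fin 1) (u.adicCompletion F) ⧸ upperUnitriangular (Fin 1) (u.adicCompletion F))]
    (ν : Measure (GL (Fin 1) (u.adicCompletion F) ⧸ upperUnitriangular (Fin 1) (u.adicCompletion F)))
    [SMulInvariantMeasure (GL (Fin 1) (u.adicCompletion F))
      (GL (Fin 1) (u.adicCompletion F) ⧸ upperUnitriangular (Fin 1) (u.adicCompletion F)) ν]
    [IsFiniteMeasureOnCompacts ν] [ν.IsOpenPosMeasure] {P : ℂ[X]}
    (hP : HasRSLFactor Nat.one_lt_two ρ'.ρ
      (Representation.trivial ℂ (GL (Fin 1) (u.adicCompletion F)) ℂ) ψ ν P) : P = 1 := by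
  -- an irreducible smooth local component `πu` of `π` at `u`; it is spherical
  obtain ⟨πu, hloc⟩ := AutomorphicRepData.exists_hasLocalComponentAt_of_isAdmissible
    (automorphicRep_isAdmissible_holds hcpt) π.1 u
  have hsph := exists_mem_fixedPoints_glInt_of_isUnramifiedAt π.1 u hπ πu hloc
  -- the local twisting character `ω_u ∘ det`: smooth, ramified
  set χ : (u.adicCompletion F)ˣ →* ℂˣ := ω.localComponent u with hχ_def
  have hχ : IsOpen (χ.ker : Set (u.adicCompletion F)ˣ) := ω.isOpen_ker_localComponent u
  have hram' : ∃ x : (u.adicCompletion F)ˣ,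
      ValuativeRel.valuation (u.adicCompletion F) (x : u.adicCompletion F) = 1 ∧ χ x ≠ 1 :=
    (ω.not_isUnramifiedAt_iff_exists_valuation_eq_one u).1 hram
  set c : GL (Fin 2) (u.adicCompletion F) →* ℂˣ := χ.comp Matrix.GeneralLinearGroup.det with hc_def
  have hc : ∀ g, c g = χ (Matrix.GeneralLinearGroup.det g) := fun g => rfl
  have hcker : IsOpen (c.ker : Set (GL (Fin 2) (u.adicCompletion F))) := isOpen_ker_of_det hχ hc
  -- the local vanishing for `πu ⊗ c`
  obtain ⟨ν₀, hinv₀, hfin₀, hpos₀, hR⟩ :=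
    hasRSLFactor_twist_eq_one_of_spherical_smoothIrrep πu hψ hsph hχ hram' hc
  haveI := hinv₀; haveI := hfin₀; haveI := hpos₀
  -- `πu ⊗ c` is a local component of `π ⊗ ω` at `u`
  have hloc' : (π.twist ω hω).1.HasLocalComponentAt u (πu.twist c hcker).ρ :=
    π.hasLocalComponentAt_twist ω hω hloc
  exact hasRSLFactor_eq_one_transport (π.twist ω hω).1 u (πu.twist c hcker) hloc' hψ ν₀ hR
    ρ' hρ' hψ ν hP

/-- **Clause (N): sufficiently ramified twists have trivial local factor, for every local component
of the global twist** (Jacquet–Langlands 1970, Prop. 3.8): for `π` cuspidal on `GL₂(𝔸_F)` and a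
finite place `u` there is `M = M(π, u) > 0` such that for every finite-order Hecke character `ω`
with `ω, ω², …, ω^M` ALL ramified at `u`, every JPSS `L`-polynomial of every irreducible smooth
local component of `π ⊗ ω` at `u` (any `ψ`, any Borel structures, any `ν`) is `1`.
[cite: JacquetLanglands1970, Prop. 3.8] -/
theorem exists_bound_hasRSLFactor_localComponent_twist_eq_one
    (π : CuspidalAutomorphicRepData 2 F hcpt) (u : HeightOneSpectrum (𝓞 F)) :
    ∃ M : ℕ, 0 < M ∧ ∀ (ω : HeckeCharacter F) (hω : ω.IsFiniteOrder),
      (∀ k : ℕ, 0 < k → k ≤ M → ¬ (ω ^ k).IsUnramifiedAt u) →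
      ∀ (ρ' : SmoothIrrep (GL (Fin 2) (u.adicCompletion F))),
        (π.twist ω hω).1.HasLocalComponentAt u ρ'.ρ →
      ∀ (ψ : AddChar (u.adicCompletion F) Circle), ψ.IsContinuousNontrivial →
      ∀ [MeasurableSpace (u.adicCompletion F)] [BorelSpace (u.adicCompletion F)]
        [MeasurableSpace (GL (Fin 1) (u.adicCompletion F) ⧸ upperUnitriangular (Fin 1) (u.adicCompletion F))]
        [BorelSpace (GL (Fin 1) (u.adicCompletion F) ⧸ upperUnitriangular (Fin 1) (u.adicCompletion F))]
        (ν : Measure (GL (Fin 1) (u.adicCompletion F) ⧸ upperUnitriangular (Fin 1) (u.adicCompletion F)))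
        [SMulInvariantMeasure (GL (Fin 1) (u.adicCompletion F))
          (GL (Fin 1) (u.adicCompletion F) ⧸ upperUnitriangular (Fin 1) (u.adicCompletion F)) ν]
        [IsFiniteMeasureOnCompacts ν] [ν.IsOpenPosMeasure] (P : ℂ[X]),
        HasRSLFactor Nat.one_lt_two ρ'.ρ
          (Representation.trivial ℂ (GL (Fin 1) (u.adicCompletion F)) ℂ) ψ ν P → P = 1 := by
  -- an irreducible smooth local component `πu` of `π` at `u`, and Tate's character `ψ₀`
  obtain ⟨πu, hloc⟩ := AutomorphicRepData.exists_hasLocalComponentAt_of_isAdmissible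
    (automorphicRep_isAdmissible_holds hcpt) π.1 u
  have hψ₀ : ((adeleAddChar F).adicComponent u).IsContinuousNontrivial :=
    (isGlobalAddChar_adeleAddChar F).isContinuousNontrivial_adicComponent
      (adicComponent_adeleAddChar_ne_one u)
  -- Borel structures and the depth `N = N(πu)`
  letI mF : MeasurableSpace (u.adicCompletion F) := borel _
  haveI : BorelSpace (u.adicCompletion F) := ⟨rfl⟩
  letI mQ : MeasurableSpace
      (GL (Fin 1) (u.adicCompletion F) ⧸ upperUnitriangular (Fin 1) (u.adicCompletion F)) := borel _
  haveI : BorelSpace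
      (GL (Fin 1) (u.adicCompletion F) ⧸ upperUnitriangular (Fin 1) (u.adicCompletion F)) := ⟨rfl⟩
  obtain ⟨N, -, hN⟩ := exists_unitFiltration_forall_hasRSLFactor_twist_eq_one_smoothIrrep πu hψ₀
  -- the index bound `M = M(u, N)`
  obtain ⟨M, hM, hMω⟩ :=
    Literature.NumberTheory.GaloisRepresentations.HeckeCharacter.exists_unitFiltration_ne_one_of_forall_pow_not_isUnramifiedAt
      (K := F) u N
  refine ⟨M, hM, fun ω hω hdeep ρ' hρ' ψ hψ mF' hBF mQ' hBQ ν hinv hfin hpos P hP => ?_⟩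
  -- normalise the Borel structures
  have hmF : mF' = mF := BorelSpace.measurable_eq
  subst hmF
  have hmQ : mQ' = mQ := BorelSpace.measurable_eq
  subst hmQ
  -- the local twisting character: smooth and non-trivial on `U^N`
  set χ : (u.adicCompletion F)ˣ →* ℂˣ := ω.localComponent u with hχ_def
  have hχ : IsOpen (χ.ker : Set (u.adicCompletion F)ˣ) := ω.isOpen_ker_localComponent u
  have hdeepχ : ∃ x ∈ unitFiltration (u.adicCompletion F) N, χ x ≠ 1 := hMω ω hdeep
  set c : GL (Fin 2) (u.adicCompletion F) →* ℂˣ := χ.comp Matrix.GeneralLinearGroup.det with hc_def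
  have hc : ∀ g, c g = χ (Matrix.GeneralLinearGroup.det g) := fun g => rfl
  have hcker : IsOpen (c.ker : Set (GL (Fin 2) (u.adicCompletion F))) := isOpen_ker_of_det hχ hc
  obtain ⟨ν₀, hinv₀, hfin₀, hpos₀, hR⟩ := hN χ hχ hdeepχ c hc
  haveI := hinv₀; haveI := hfin₀; haveI := hpos₀
  have hloc' : (π.twist ω hω).1.HasLocalComponentAt u (πu.twist c hcker).ρ :=
    π.hasLocalComponentAt_twist ω hω hloc
  exact hasRSLFactor_eq_one_transport (π.twist ω hω).1 u (πu.twist c hcker) hloc' hψ₀ ν₀ hR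
    ρ' hρ' hψ ν hP

end Literature.NumberTheory.Automorphic

end
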